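import Mathlib
import Summits.Ventures.HodgeRepro2.T5SmoothDual

/-!
# The smooth dual as a representation: `π̃ : Representation k G (SmoothDualSpace ρ)`

Blind cell `pub-hodge-repro2`, seat p8 (gen 8), Tier-5 kernel support.  `T5SmoothDual` (T5-55)
records the smooth dual `π̃ = (V^*)^∞` at the level of subspaces of the algebraic dual
(`smoothDualInvariants ρ K = (π̃)^K`), because a `Representation` on the nested subtype
`↥(smoothVectors ρ.dual)` does not unify downstream (annex §62).  This file supplies the missing
object: an OPAQUE carrier `SmoothDualSpace ρ` (a one-field structure over `smoothVectors ρ.dual`)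
with its own `AddCommGroup` / `Module k` instances, and on it

* `smoothDualRep ρ : Representation k G (SmoothDualSpace ρ)` — THE SMOOTH DUAL AS A REPRESENTATION
  (`smoothDualRep_val`: it acts through `ρ.dual`; `smoothDualRep_apply_apply`: the invariant pairing);
* `isSmooth_smoothDualRep` — it is smooth (Mathlib-free: `LevelPositivity.IsSmooth`);
* `invariantsEquivSmoothDualInvariants : invariants (smoothDualRep ρ) K ≃ₗ[k] smoothDualInvariants ρ K`
  and `invariantsSmoothDualRepEquiv : invariants (smoothDualRep ρ) K ≃ₗ[k] Module.Dual k (invariants ρ K)`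
  — `(π̃)^K ≅ (π^K)^*` in the `Representation` language (`K` open, `ρ` `K`-finite, characteristic `0`);
* `finrank_invariants_smoothDualRep`, `isAdmissible_smoothDualRep` — `π̃` is admissible when `π` is.

README §8(d): uses an L-value-free non-vanishing device: NO.
-/

namespace Summit.Ventures.HodgeRepro2.T5SmoothDualRep

noncomputable section

open Summit.Ventures.HodgeRepro2.LevelPositivity
open Summit.Ventures.HodgeRepro2.T5LevelIdempotent
open Summit.Ventures.HodgeRepro2.T5AdmissibleTransfer
open Summit.Ventures.HodgeRepro2.T5SmoothDual

variable {G : Type*} [Group G] [TopologicalSpace G] [IsTopologicalGroup G]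
  {k : Type*} [Field k] {V : Type*} [AddCommGroup V] [Module k V]

/-- The carrier of the smooth dual: an opaque wrapper around the smooth vectors of `ρ.dual`. -/
structure SmoothDualSpace (ρ : Representation k G V) where
  /-- The underlying smooth functional. -/
  val : smoothVectors ρ.dual

namespace SmoothDualSpace

variable {ρ : Representation k G V}

/-- Extensionality. -/
@[ext] theorem ext {a b : SmoothDualSpace ρ} (h : a.val = b.val) : a = b := by
  cases a
  cases b
  congr

/-- `val` is injective. -/
theorem val_injective : Function.Injective (val : SmoothDualSpace ρ → smoothVectors ρ.dual) :=
  fun _ _ h => ext h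

/-- Addition, through `val`. -/
instance : Add (SmoothDualSpace ρ) := ⟨fun a b => ⟨a.val + b.val⟩⟩
/-- Zero, through `val`. -/
instance : Zero (SmoothDualSpace ρ) := ⟨⟨0⟩⟩
/-- Negation, through `val`. -/
instance : Neg (SmoothDualSpace ρ) := ⟨fun a => ⟨-a.val⟩⟩
/-- Subtraction, through `val`. -/
instance : Sub (SmoothDualSpace ρ) := ⟨fun a b => ⟨a.val - b.val⟩⟩
/-- The `ℕ`-action, through `val`. -/
instance : SMul ℕ (SmoothDualSpace ρ) := ⟨fun n a => ⟨n • a.val⟩⟩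
/-- The `ℤ`-action, through `val`. -/
instance : SMul ℤ (SmoothDualSpace ρ) := ⟨fun n a => ⟨n • a.val⟩⟩
/-- The `k`-action, through `val`. -/
instance : SMul k (SmoothDualSpace ρ) := ⟨fun c a => ⟨c • a.val⟩⟩

/-- `val` of a sum. -/
@[simp] theorem val_add (a b : SmoothDualSpace ρ) : (a + b).val = a.val + b.val := rfl
/-- `val` of zero. -/
@[simp] theorem val_zero : (0 : SmoothDualSpace ρ).val = 0 := rfl
/-- `val` of a scalar multiple. -/
@[simp] theorem val_smul (c : k) (a : SmoothDualSpace ρ) : (c • a).val = c • a.val := rfl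

/-- The additive group structure, transported along the injection `val`. -/
instance : AddCommGroup (SmoothDualSpace ρ) :=
  val_injective.addCommGroup val rfl (fun _ _ => rfl) (fun _ => rfl) (fun _ _ => rfl)
    (fun _ _ => rfl) (fun _ _ => rfl)

/-- The `k`-module structure, transported along the injection `val`. -/
instance : Module k (SmoothDualSpace ρ) :=
  val_injective.module k ⟨⟨val, rfl⟩, fun _ _ => rfl⟩ fun _ _ => rfl

/-- `val` as a linear equivalence with the smooth vectors of `ρ.dual`. -/
def valEquiv : SmoothDualSpace ρ ≃ₗ[k] smoothVectors ρ.dual where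
  toFun := val
  map_add' _ _ := rfl
  map_smul' _ _ := rfl
  invFun := mk
  left_inv _ := rfl
  right_inv _ := rfl

/-- `valEquiv` applies `val`. -/
@[simp] theorem valEquiv_apply (a : SmoothDualSpace ρ) : valEquiv a = a.val := rfl

/-- `valEquiv.symm` is `mk`. -/
@[simp] theorem valEquiv_symm_apply (l : smoothVectors ρ.dual) : (valEquiv (ρ := ρ)).symm l = ⟨l⟩ :=
  rfl

end SmoothDualSpace

open SmoothDualSpace

variable (ρ : Representation k G V)

/-- THE SMOOTH DUAL AS A REPRESENTATION of `G` on the opaque carrier `SmoothDualSpace ρ`. -/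
def smoothDualRep : Representation k G (SmoothDualSpace ρ) where
  toFun g := (valEquiv (ρ := ρ)).symm.toLinearMap ∘ₗ smoothRep ρ.dual g ∘ₗ
    (valEquiv (ρ := ρ)).toLinearMap
  map_one' := by
    ext a
    simp
  map_mul' g h := by
    ext a
    simp

/-- `smoothDualRep` acts through `smoothRep ρ.dual`, i.e. through `ρ.dual`. -/
@[simp] theorem smoothDualRep_val (g : G) (a : SmoothDualSpace ρ) :
    (smoothDualRep ρ g a).val = smoothRep ρ.dual g a.val := rfl

/-- The functional underlying `smoothDualRep ρ g a` is `ρ.dual g` of that of `a`. -/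
theorem coe_smoothDualRep_val (g : G) (a : SmoothDualSpace ρ) :
    ((smoothDualRep ρ g a).val : Module.Dual k V) = ρ.dual g a.val := rfl

/-- The invariant pairing `⟨π̃(g) a, π(g) v⟩ = ⟨a, v⟩`. -/
theorem smoothDualRep_apply_apply (g : G) (a : SmoothDualSpace ρ) (v : V) :
    ((smoothDualRep ρ g a).val : Module.Dual k V) (ρ g v) = (a.val : Module.Dual k V) v := by
  rw [coe_smoothDualRep_val, dual_apply_apply]

/-- The stabiliser of `a` under `smoothDualRep` is the stabiliser of its functional under `ρ.dual`. -/
theorem coe_stabilizer_smoothDualRep (a : SmoothDualSpace ρ) :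
    (stabilizer (smoothDualRep ρ) a : Set G) = stabilizer ρ.dual (a.val : Module.Dual k V) := by
  ext g
  simp only [SetLike.mem_coe, mem_stabilizer_iff]
  constructor
  · intro h
    have := congrArg (fun b : SmoothDualSpace ρ => (b.val : Module.Dual k V)) h
    simpa using this
  · intro h
    apply SmoothDualSpace.ext
    apply Subtype.ext
    simpa using h

/-- THE SMOOTH DUAL IS SMOOTH. -/
theorem isSmooth_smoothDualRep : IsSmooth (smoothDualRep ρ) := by
  intro a
  rw [coe_stabilizer_smoothDualRep]
  exact a.val.2

variable {K : Subgroup G}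

/-- `(π̃)^K` in the representation language is `smoothDualInvariants ρ K` of T5-55. -/
def invariantsEquivSmoothDualInvariants :
    invariants (smoothDualRep ρ) K ≃ₗ[k] smoothDualInvariants ρ K where
  toFun a := ⟨(a.1.val : Module.Dual k V), by
    rw [mem_smoothDualInvariants_iff]
    refine ⟨?_, a.1.val.2⟩
    rw [mem_invariants_iff]
    intro g hg
    have := congrArg (fun b : SmoothDualSpace ρ => (b.val : Module.Dual k V))
      (mem_invariants_iff.mp a.2 g hg)
    simpa using this⟩
  map_add' _ _ := rfl
  map_smul' _ _ := rfl
  invFun l := ⟨⟨⟨l.1, ((mem_smoothDualInvariants_iff (ρ := ρ)).mp l.2).2⟩⟩, by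
    rw [mem_invariants_iff]
    intro g hg
    apply SmoothDualSpace.ext
    apply Subtype.ext
    exact mem_invariants_iff.mp ((mem_smoothDualInvariants_iff (ρ := ρ)).mp l.2).1 g hg⟩
  left_inv _ := rfl
  right_inv _ := rfl

/-- `invariantsEquivSmoothDualInvariants` extracts the functional. -/
@[simp] theorem invariantsEquivSmoothDualInvariants_apply (a : invariants (smoothDualRep ρ) K) :
    (invariantsEquivSmoothDualInvariants ρ a : Module.Dual k V) = a.1.val := rfl

variable [CharZero k]

/-- `(π̃)^K ≅ (π^K)^*` IN THE REPRESENTATION LANGUAGE (`K` open, `ρ` `K`-finite, characteristic `0`). -/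
def invariantsSmoothDualRepEquiv (hK : IsOpen (K : Set G)) (hρ : KFinite ρ K) :
    invariants (smoothDualRep ρ) K ≃ₗ[k] Module.Dual k (invariants ρ K) :=
  (invariantsEquivSmoothDualInvariants ρ).trans (smoothDualInvariantsEquiv ρ hK hρ)

/-- `invariantsSmoothDualRepEquiv` is evaluation. -/
theorem invariantsSmoothDualRepEquiv_apply (hK : IsOpen (K : Set G)) (hρ : KFinite ρ K)
    (a : invariants (smoothDualRep ρ) K) (x : invariants ρ K) :
    invariantsSmoothDualRepEquiv ρ hK hρ a x = (a.1.val : Module.Dual k V) x := by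
  simp [invariantsSmoothDualRepEquiv, smoothDualInvariantsEquiv_apply]

/-- `dim (π̃)^K = dim π^K`. -/
theorem finrank_invariants_smoothDualRep (hK : IsOpen (K : Set G)) (hρ : KFinite ρ K) :
    Module.finrank k (invariants (smoothDualRep ρ) K) = Module.finrank k (invariants ρ K) := by
  rw [LinearEquiv.finrank_eq (invariantsEquivSmoothDualInvariants ρ),
    finrank_smoothDualInvariants ρ hK hρ]

/-- `(π̃)^K` is finite-dimensional when `π^K` is. -/
theorem finiteDimensional_invariants_smoothDualRep (hK : IsOpen (K : Set G)) (hρ : KFinite ρ K)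
    [FiniteDimensional k (invariants ρ K)] :
    FiniteDimensional k (invariants (smoothDualRep ρ) K) := by
  haveI := finiteDimensional_smoothDualInvariants ρ hK hρ
  exact LinearEquiv.finiteDimensional (V := smoothDualInvariants ρ K)
    (V₂ := invariants (smoothDualRep ρ) K) (invariantsEquivSmoothDualInvariants ρ (K := K)).symm

/-- THE SMOOTH DUAL OF AN ADMISSIBLE REPRESENTATION IS ADMISSIBLE, in the representation language. -/
theorem isAdmissible_smoothDualRep {𝒦 : Set (Subgroup G)} (hopen : ∀ K ∈ 𝒦, IsOpen (K : Set G))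
    (hfin : ∀ K ∈ 𝒦, KFinite ρ K) (h : IsAdmissible ρ 𝒦) : IsAdmissible (smoothDualRep ρ) 𝒦 := by
  intro K hK
  haveI := h K hK
  exact finiteDimensional_invariants_smoothDualRep ρ (hopen K hK) (hfin K hK)

end

end Summit.Ventures.HodgeRepro2.T5SmoothDualRep
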